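import Summits.AtomisticToContinuum.FouriersLaw.Theses.TransferKernelPositivity
import Summits.AtomisticToContinuum.FouriersLaw.Theorems.LocalOhmBVLocalOhmGlue

/-!
# `TransferKernelPositivity.BoundedResponseGlue` (item stmt-AtomisticToContinuum-12014)

`BoundedResponseGlue : LocalOhm → BVProfile → FiniteResponseProfile → (bounded response along every steady family)`
is the local-to-global finite-sum bookkeeping of the sign-regularity line: summing the local Ohm inequality over the
`N − 2b − 1` bulk bonds against the `N`-uniform total variation of the response profile gives
`(N−2b−1)|D_N|/(N−1) ≤ max(C,0)(2ℓ+1)·C_BV` (each bond lies in at most `2ℓ+1` windows), hence `|D_N| ≤ 2K`, and the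
finitely many short chains are absorbed. This is VERBATIM the landed glue of the sister route `LocalOhmBV`
(`localOhmGlue_proof : LocalOhmBV.LocalOhmGlue = FiniteResponseProfile → LocalOhm → BVProfile → …`,
`Theorems/LocalOhmBVLocalOhmGlue.lean`, item stmt-AtomisticToContinuum-12072) with the antecedents permuted: the route
decls `LocalOhm`, `BVProfile`, `FiniteResponseProfile` of the two routes have identical bodies (shared items
stmt-12009 / 12012 / 12011), so the same term proves both. No definitions. [folklore]
-/

namespace Summit.AtomisticToContinuum.FouriersLaw.Theorems

/-- **`BoundedResponseGlue` holds** (route `TransferKernelPositivity`, item stmt-AtomisticToContinuum-12014):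
`LocalOhm → BVProfile → FiniteResponseProfile →` bounded response `BddAbove (range |D_N|)` along every steady-state
family under weak-NESS uniqueness — by the landed `localOhmGlue_proof` of route `LocalOhmBV` (same statement up to the
order of the three antecedents; the shared route decls are definitionally equal). [folklore] -/
theorem boundedResponseGlue_proof :
    _root_.Summit.AtomisticToContinuum.FouriersLaw.Theses.TransferKernelPositivity.BoundedResponseGlue :=
  fun hL hB hF => localOhmGlue_proof hF hL hB

end Summit.AtomisticToContinuum.FouriersLaw.Theorems
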